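import Literature.MathematicalPhysics.QuantumFieldTheory.Balaban1983to89.B9SmoothHolderClassSliceSN

/-!
# `Balaban1983to89.B9SmoothHolderClassPI` — T. Bałaban, *Propagators for lattice gauge theories in a background field*, Commun. Math. Phys. **99** (1985) 389–434
# [Balaban1985BackgroundPropagators], (3.44)–(3.45) p. 398: the PRINT-EXACT transported input classes `bHZPI g s` (sites), `bHZKPI g s` (bonds) — a unit member has
# `‖F‖^{ξ}_s + |F| ≦ 1` VERBATIM the input functional of (3.44)∕(3.45) — the total exponent family `bHZPIfam`, the (2.60) weight moves, and the direction-slice comparison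
# between the print-exact bond and site classes

[4] = T. Bałaban, *Propagators and renormalization transformations for lattice gauge theories. II*, Commun. Math. Phys. **96** (1984) 223–250 [`Balaban1984PropagatorsII`].
statement-level skeleton of published theorems with citation tags; proofs where landed; nothing here is a claim about the Yang–Mills mass gap.

THE PRINT.  (3.40) p. 397 (the transported Hölder quotient `|x − x′|^{−α}|R(U(Γ_{x,x′}))A(x′) − A(x)|`, «the η-scale is used … another scale … indicated by a superscript»);
(3.44)–(3.45) p. 398 «|(∇_UG′(U)∇\*_Uλ)(x)| ≦ B′₀(ε)e^{−δ₀d(y,y′)}(‖λ‖^{ξ′}_ε + |λ|)», «‖ζ∇_UG′(U)∇\*_Uλ‖_β ≦ B′₀(ε,β)(Lʲη)^{−β}(…)e^{−δ₀d(y,y′)}(‖λ‖^{ξ′}_{β+ε} + |λ|)», `ξ′ = Lʲ′η`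
the scale of the source block; Cor. 3.6 p. 408 (the same inequalities for the local operators `G′_□`); [4] Lemma 2.1 (2.60) p. 234 and (2.51)–(2.52) p. 232.

WHY THIS FILE (cell `pub-ymgap`, Track A node N06 [B9], seat `pub-ymgap-dag-n06-c` g20; the `h44G ∕ hp45W` road of the G′ Hölder layer of rows 20–21, dag-n06-d's
`DISPLAY-LEDGER-UF.md` §2; this seat's LOCATED-20).  The rows-20–21 consumers are typed over dag-n06-l's TRANSPORTED print-weighted classes `bHZKP (taxiB U) s`
(`B9SmoothHolderClassP`: `loc = (Lʲη)⁻¹·sup + (Lʲη)^{s−1}·pair_s`), while the rows-18 input legs `InputLegsPair37 ∕ FactorsInputPair37Dir` of the (3.44)∕(3.45) engine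
(`B9RWSums344InputPairDir.inputPair3445_of_local37_dir`, abstract class `bHX : ℝ → BlockNorm`, BLOCK-UNIFORM leg constants `BI ε`) are pinned at the FLAT class `bHS`; flat and
transported classes are incomparable over print's class (3.35) (bond variables arbitrary up to a cube-wise gauge), so the engine must be run at a transported class, and the
block-uniform constants force the normalisation whose local size IS print's functional: `Lʲη·bHZP = sup_{Δ̃(y)}|F| + (Lʲη)^{s}·pair_s = |F| + ‖F‖^{ξ}_s`.
* §1 ★ `bHZPI g s := weightNorm (bHZP g s) (Lʲη)` (`bHZPI_loc`, ★ `bHZPI_loc_print`, `bHZPI_κ`, `bHZPI_isLoc_iff`, `bHZPI_cut_apply`, `bHZPI_isLoc_of_blkOf`), the bond twin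
  ★ `bHZKPI g s` (same API), and the TOTAL family ★ `bHZPIfam g : ℝ → BlockNorm` (`= bHZPI g s` on `s ∈ [0,1]`, `bHZPIfam_of_mem`) — the engine's `bHX`.
* §2 the (2.60) weight moves between `weightNorm N (Lʲη)`-sources and the `𝔠^{(t)}` targets: `hasMaj_cNormR_zero_of_ofBlocks`, `hasMaj_cNormR_of_target_rpow`,
  ★ `hasMaj_unweight_src_cNormR` (`weightNorm N (Lʲη) → 𝔠^{(t)}` at `K e^{−ρd}` gives `N → 𝔠^{(t−1)}` at `A·K·e^{−(ρ−ε)d}` under the scale transfer `Lʲ′η ≤ A e^{εd} Lʲη`),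
  and the transfer itself above an `M`-threshold, `len_le_transfer_geo9K` ([4] (2.60), `B9GeoLemma21KLevelV1.transferL_geo9K`).
* §3 ★★ `hasMaj_dirSliceK_bHZKPI_bHZPI` — this lineage's B1 `B9SmoothHolderClassSliceSN.hasMaj_dirSliceK_bHZKP_bHZP` re-weighted on both sides by (2.60): the direction slice
  `dirSliceK μ ν : bHZKPI (taxiB U) s → bHZPI (taxiS U) s`, majorant `L·C_σ·e^{δ r_σ}·e^{−(δ−ε)d}` above the transfer threshold.
HONEST SCOPE.  Definitions + linear bookkeeping over landed objects (dag-n06-l's `bHZP ∕ bHZKP`, dag-n06-j∕c's `B9SectDSup.weightNorm`, this lineage's B1); nothing of [B9]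
asserted; no certificate edition written; COUNT-NEUTRAL; N06 NOT discharged; one finite 𝕋^{d+1} programme at fixed ε — nothing continuum, nothing about the mass gap.
Cell `pub-ymgap` (HUMAN RULING D-0062), Track A node N06 [B9], seat `pub-ymgap-dag-n06-c` (g20), 2026-08-29; a NEW file; 3 `def`, no `sorry`, no `axiom`, no
`instance`, no `notation`.
-/

noncomputable section

namespace Literature.MathematicalPhysics.QuantumFieldTheory.Balaban1983to89.B9SmoothHolderClassPI

open B6GlobalChartV1 (PV blkV1)
open B6Geom246MultiLevelBox (blkOf)
open B6Geom246MultiLevelTorus (geomT)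
open B6Ineq2142KLevelV1 (β lvl)
open B6KLevelCensusIndexV1 (KIdx kGeo)
open B6Prop22KLevelTorusCensusEta (nKT nKT_pos)
open B6Cor28 (TransferL)
open B9GeoNormsKLevelV1 (geo9K geo9K_dist_nonneg)
open B9GeoLemma21KLevelV1 (geo9K_len_pos transferL_geo9K)
open B9Thm34Ext (toB6)
open B9SectDSup (weightNorm weightNorm_loc)
open B11SectG (BlockNorm HasMaj)
open B11SectGGlobal (Size)
open B11SectGGlobalSizes
open B11SectGSmoothCutT (Size.ofPairsT)
open B9CoReadingCoords (XBK)
open B9CoReadingCoordsS (XSK)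
open B9MultiscaleSmoothPartitionY (zeta NearY)
open B9MultiscaleSmoothPartitionYLip (CLip CLip_nonneg)
open B9MultiscaleSmoothPartitionYNear (rNear)
open B9SmoothHolderClassS (NearPair wEta wEta_nonneg)
open B9SmoothHolderClassK (srcY NearPairK wEtaK wEtaK_nonneg)
open B9SmoothHolderClassT (trDif)
open B9SmoothHolderClassP (bHZP bHZP_κ bHZP_loc_print bHZP_isLoc_iff bHZP_cut_apply bHZP_isLoc_of_blkOf bHZKP bHZKP_κ bHZKP_loc_print bHZKP_isLoc_iff
  bHZKP_cut_apply bHZKP_isLoc_of_blkV1)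
open B9SmoothHolderClassSliceSN (hasMaj_dirSliceK_bHZKP_bHZP)
open B9GradViaDivLettersTransported (taxiS taxiB)
open B9Thm39ReadingCoords (coordBound39 basisBound39)
open B9Thm312Whole (GeoOK)
open B9Thm312WholeClasses (cNormR cNormR_loc)
open Node00 (SiteY FBondY IBondY CfgY toKT levY)
open Node00.OpsYNablaBridge (dirSliceK)
open T4RelativeLadder (UnitaryLike)

variable {d ℓ : ℕ} {hd : 1 ≤ d + 1} {hL : Odd (ℓ + 1) ∧ 1 < ℓ + 1} {b₀ b₁ : ℝ}
variable {𝔸 : Type} [NormedRing 𝔸] [NormedAlgebra ℂ 𝔸]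
variable {κ : Type} [Fintype κ]
variable (i : KIdx d ℓ hd hL b₀ b₁) [Fintype (geo9K i).Site] (b : Module.Basis κ ℝ 𝔸)

/-! ## §1 ★ The print-exact transported classes `bHZPI g s` (sites), `bHZKPI g s` (bonds), and the total family `bHZPIfam g` -/

section Site

variable (g : SiteY i → SiteY i → 𝔸ˣ) {R : ℝ} {H : Prop}

/-- ★ **THE PRINT-EXACT TRANSPORTED SITE INPUT CLASS `bHZPI g s`** := dag-n06-l's print-weighted class `bHZP g s` re-weighted by the block length `Lʲη`:
`loc y F = Lʲη·[(Lʲη)⁻¹·sup_{Δ̃(y)}|F| + (Lʲη)^{s−1}·pair_s] = sup_{Δ̃(y)}|F| + (Lʲη)^{s}·‖F‖_{s,η,y} = |F| + ‖F‖^{ξ}_s` (`ξ = Lʲη`) — VERBATIM the input functional of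
(3.44)∕(3.45); same cut `ζ_y·`, same localisation, κ = `1 + C_Lip`. [cite: Balaban1985BackgroundPropagators, (3.40) p.397 + (3.44)–(3.45) p.398 («‖λ‖^{ξ′}_ε + |λ|») + Cor. 3.6 p.408; Balaban1984PropagatorsII, (2.51)–(2.52) p.232] -/
def bHZPI {s : ℝ} (hs0 : 0 ≤ s) (hs1 : s ≤ 1) : BlockNorm (toB6 (geo9K i) R H) (XSK κ i → ℝ) :=
  weightNorm (bHZP (κ := κ) i b g (R := R) (H := H) hs0 hs1) (fun y => (geo9K i).len y) (fun y => (geo9K_len_pos i y).le)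

variable {s : ℝ} (hs0 : 0 ≤ s) (hs1 : s ≤ 1)

/-- the cutting cost is `1 + C_Lip(d, L)`. [cite: Balaban1984PropagatorsII, (2.52) p.232; Balaban1985BackgroundPropagators, (3.43) p.398] -/
theorem bHZPI_κ : (bHZPI (κ := κ) i b g (R := R) (H := H) hs0 hs1).κ = 1 + CLip d ℓ := rfl

/-- the local size: `Lʲη × (the print-weighted size)`. [cite: Balaban1985BackgroundPropagators, (3.40) p.397 + (3.44) p.398, bookkeeping] -/
theorem bHZPI_loc (y : IBondY i) (F : XSK κ i → ℝ) :
    (bHZPI (κ := κ) i b g (R := R) (H := H) hs0 hs1).loc y F = (geo9K i).len y * (bHZP (κ := κ) i b g (R := R) (H := H) hs0 hs1).loc y F := rfl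

open Classical in
/-- ★ **THE PRINT-LITERAL READING**: at print's units (`|c_f| = Lᵏ`) `loc y F = sup_{Δ̃(y)}|F| + (Lʲη)^{s}·pair_s` — the sup channel UNWEIGHTED (`|λ|`) and the η-scale
transported Hölder seminorm at the source scale `ξ′ = Lʲη` (`‖λ‖^{ξ′}_s = (Lʲη)^s‖λ‖_{s,η}`): «‖λ‖^{ξ′}_s + |λ|». [cite: Balaban1985BackgroundPropagators, (3.40) p.397 + (3.44)–(3.45) p.398; Balaban1984PropagatorsII, (2.1) p.224] -/
theorem bHZPI_loc_print (hcf : |i.cf| = (nKT (toKT i) : ℝ)) (y : IBondY i) (F : XSK κ i → ℝ) :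
    (bHZPI (κ := κ) i b g (R := R) (H := H) hs0 hs1).loc y F =
      (Size.ofSup (toB6 (geo9K i) R H) (fun (q : XSK κ i) (y : IBondY i) => NearY i y q.1)).sz y F +
        (geo9K i).len y ^ s * (Size.ofPairsT (toB6 (geo9K i) R H) (fun (q : XSK κ i) (y : IBondY i) => NearY i y q.1) (NearPair i) (wEta i s)
          (wEta_nonneg i s) (trDif b g)).sz y F := by
  have hΛ : 0 < (geo9K i).len y := geo9K_len_pos i y
  rw [bHZPI_loc, bHZP_loc_print i b g hs0 hs1 hcf y F, mul_add, ← mul_assoc, mul_inv_cancel₀ hΛ.ne', one_mul, ← mul_assoc]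
  congr 1
  rw [show (geo9K i).len y * (geo9K i).len y ^ (s - 1) = (geo9K i).len y ^ (1 : ℝ) * (geo9K i).len y ^ (s - 1) by rw [Real.rpow_one],
    ← Real.rpow_add hΛ, show (1 : ℝ) + (s - 1) = s by ring]

/-- localisation at `y` = the vector vanishes off `Δ̃(y)`. [cite: Balaban1985BackgroundPropagators, (3.44) p.398, bookkeeping] -/
theorem bHZPI_isLoc_iff (y : IBondY i) (F : XSK κ i → ℝ) :
    (bHZPI (κ := κ) i b g (R := R) (H := H) hs0 hs1).IsLoc y F ↔ ∀ q : XSK κ i, ¬ NearY i y q.1 → F q = 0 :=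
  bHZP_isLoc_iff i b g (R := R) (H := H) hs0 hs1 y F

/-- the cut-off is the multiplication by `ζ_y`. [cite: Balaban1985BackgroundPropagators, (3.43) p.398, bookkeeping] -/
theorem bHZPI_cut_apply (y : IBondY i) (F : XSK κ i → ℝ) (q : XSK κ i) :
    (bHZPI (κ := κ) i b g (R := R) (H := H) hs0 hs1).cut y F q = zeta i y q.1 * F q :=
  bHZP_cut_apply i b g (R := R) (H := H) hs0 hs1 y F q

/-- sharp localisation over the carrier block implies localisation in `bHZPI`. [cite: Balaban1985BackgroundPropagators, (3.44) p.398 («supp λ ⊂ Δ̃(y′)»), bookkeeping] -/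
theorem bHZPI_isLoc_of_blkOf (y : IBondY i) (F : XSK κ i → ℝ) (hF : ∀ q : XSK κ i, blkOf i.D.toDomains q.1 ≠ β i.hN i.D i.hk y → F q = 0) :
    (bHZPI (κ := κ) i b g (R := R) (H := H) hs0 hs1).IsLoc y F :=
  bHZP_isLoc_of_blkOf i b g (R := R) (H := H) hs0 hs1 y F hF

/-- ★ **THE TOTAL EXPONENT FAMILY `bHZPIfam g : ℝ → BlockNorm`** — `bHZPI g s` for `s ∈ [0,1]` (the junk value `bHZPI g ½` elsewhere): the shape of the abstract input class
`bHX : ℝ → BlockNorm` of the (3.44)∕(3.45) engines (`B9RWSums344InputPair(Dir)`), whose legs quantify `∀ ε, 0 < ε → ε ≤ 1`. [cite: Balaban1985BackgroundPropagators, (3.44)–(3.45) p.398 + Cor. 3.6 p.408, dictionary] -/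
def bHZPIfam : ℝ → BlockNorm (toB6 (geo9K i) R H) (XSK κ i → ℝ) := fun ε =>
  if h : 0 ≤ ε ∧ ε ≤ 1 then bHZPI (κ := κ) i b g (R := R) (H := H) h.1 h.2
  else bHZPI (κ := κ) i b g (R := R) (H := H) (s := 1 / 2) (by norm_num) (by norm_num)

/-- on `[0,1]` the family IS the print-exact class. [cite: Balaban1985BackgroundPropagators, (3.44) p.398, bookkeeping] -/
theorem bHZPIfam_of_mem {ε : ℝ} (h0 : 0 ≤ ε) (h1 : ε ≤ 1) :
    bHZPIfam (κ := κ) i b g (R := R) (H := H) ε = bHZPI (κ := κ) i b g (R := R) (H := H) h0 h1 := by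
  unfold bHZPIfam
  rw [dif_pos ⟨h0, h1⟩]

end Site

section Bond

variable (g : FBondY i → FBondY i → 𝔸ˣ) {R : ℝ} {H : Prop}

/-- ★ **THE PRINT-EXACT TRANSPORTED BOND INPUT CLASS `bHZKPI g s`** := `weightNorm (bHZKP g s) (Lʲη)`: `loc y F = sup_{bonds sourced in Δ̃(y)}|F| + (Lʲη)^{s}·pair_s =
|F| + ‖F‖^{ξ}_s` on the bond carrier. [cite: Balaban1985BackgroundPropagators, (3.40) p.397 + (3.44)–(3.45) p.398 + p.398 (remark after (3.47)); Balaban1984PropagatorsII, (2.51)–(2.52) p.232, (2.137) p.247] -/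
def bHZKPI {s : ℝ} (hs0 : 0 ≤ s) (hs1 : s ≤ 1) : BlockNorm (toB6 (geo9K i) R H) (XBK κ i → ℝ) :=
  weightNorm (bHZKP (κ := κ) i b g (R := R) (H := H) hs0 hs1) (fun y => (geo9K i).len y) (fun y => (geo9K_len_pos i y).le)

variable {s : ℝ} (hs0 : 0 ≤ s) (hs1 : s ≤ 1)

/-- the cutting cost is `1 + C_Lip(d, L)`. [cite: Balaban1984PropagatorsII, (2.52) p.232; Balaban1985BackgroundPropagators, (3.43) p.398] -/
theorem bHZKPI_κ : (bHZKPI (κ := κ) i b g (R := R) (H := H) hs0 hs1).κ = 1 + CLip d ℓ := rfl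

/-- the local size: `Lʲη × (the print-weighted bond size)`. [cite: Balaban1985BackgroundPropagators, (3.40) p.397 + (3.44) p.398, bookkeeping] -/
theorem bHZKPI_loc (y : IBondY i) (F : XBK κ i → ℝ) :
    (bHZKPI (κ := κ) i b g (R := R) (H := H) hs0 hs1).loc y F = (geo9K i).len y * (bHZKP (κ := κ) i b g (R := R) (H := H) hs0 hs1).loc y F := rfl

open Classical in
/-- ★ the print-literal reading on bonds: `loc y F = sup|F| + (Lʲη)^{s}·pair_s = |F| + ‖F‖^{ξ}_s`. [cite: Balaban1985BackgroundPropagators, (3.40) p.397 + (3.44)–(3.45) p.398; Balaban1984PropagatorsII, (2.1) p.224] -/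
theorem bHZKPI_loc_print (hcf : |i.cf| = (nKT (toKT i) : ℝ)) (y : IBondY i) (F : XBK κ i → ℝ) :
    (bHZKPI (κ := κ) i b g (R := R) (H := H) hs0 hs1).loc y F =
      (Size.ofSup (toB6 (geo9K i) R H) (fun (q : XBK κ i) (y : IBondY i) => NearY i y (srcY i q))).sz y F +
        (geo9K i).len y ^ s * (Size.ofPairsT (toB6 (geo9K i) R H) (fun (q : XBK κ i) (y : IBondY i) => NearY i y (srcY i q)) (NearPairK i) (wEtaK i s)
          (wEtaK_nonneg i s) (trDif b g)).sz y F := by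
  have hΛ : 0 < (geo9K i).len y := geo9K_len_pos i y
  rw [bHZKPI_loc, bHZKP_loc_print i b g hs0 hs1 hcf y F, mul_add, ← mul_assoc, mul_inv_cancel₀ hΛ.ne', one_mul, ← mul_assoc]
  congr 1
  rw [show (geo9K i).len y * (geo9K i).len y ^ (s - 1) = (geo9K i).len y ^ (1 : ℝ) * (geo9K i).len y ^ (s - 1) by rw [Real.rpow_one],
    ← Real.rpow_add hΛ, show (1 : ℝ) + (s - 1) = s by ring]

/-- localisation at `y` = the bond vector vanishes at bonds sourced off `Δ̃(y)`. [cite: Balaban1985BackgroundPropagators, (3.44) p.398, bookkeeping] -/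
theorem bHZKPI_isLoc_iff (y : IBondY i) (F : XBK κ i → ℝ) :
    (bHZKPI (κ := κ) i b g (R := R) (H := H) hs0 hs1).IsLoc y F ↔ ∀ q : XBK κ i, ¬ NearY i y (srcY i q) → F q = 0 :=
  bHZKP_isLoc_iff i b g (R := R) (H := H) hs0 hs1 y F

/-- the cut-off is the multiplication by `ζ_y` at the charted source site. [cite: Balaban1985BackgroundPropagators, (3.43) p.398, bookkeeping] -/
theorem bHZKPI_cut_apply (y : IBondY i) (F : XBK κ i → ℝ) (q : XBK κ i) :
    (bHZKPI (κ := κ) i b g (R := R) (H := H) hs0 hs1).cut y F q = zeta i y (srcY i q) * F q :=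
  bHZKP_cut_apply i b g (R := R) (H := H) hs0 hs1 y F q

/-- sharp localisation over the carrier block implies localisation in `bHZKPI`. [cite: Balaban1985BackgroundPropagators, p.398 (remark after (3.47): «supp J ⊂ Δ(y′)»), bookkeeping] -/
theorem bHZKPI_isLoc_of_blkV1 (y : IBondY i) (F : XBK κ i → ℝ) (hF : ∀ q : XBK κ i, blkV1 i.hN i.D q.1 ≠ β i.hN i.D i.hk y → F q = 0) :
    (bHZKPI (κ := κ) i b g (R := R) (H := H) hs0 hs1).IsLoc y F :=
  bHZKP_isLoc_of_blkV1 i b g (R := R) (H := H) hs0 hs1 y F hF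

/-- a majorant FROM the print-weighted bond class is a majorant from the print-exact one with the source length moved into the kernel: `K′(y,y′) = K(y,y′)∕(L^{j′}η)`
(exact re-weighting, p. 398 «the choice of powers Lʲη is conventional»). [cite: Balaban1985BackgroundPropagators, p.398 (remark after (3.47)); Balaban1984PropagatorsII, (2.51) p.232] -/
theorem hasMaj_bHZKPI_of_bHZKP {F₂ : Type} [AddCommGroup F₂] [Module ℝ F₂] {b₂ : BlockNorm (toB6 (geo9K i) R H) F₂} {T : (XBK κ i → ℝ) →ₗ[ℝ] F₂}
    {K : IBondY i → IBondY i → ℝ} (h : HasMaj (bHZKP (κ := κ) i b g (R := R) (H := H) hs0 hs1) b₂ T K) :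
    HasMaj (bHZKPI (κ := κ) i b g (R := R) (H := H) hs0 hs1) b₂ T (fun y y' => K y y' * ((geo9K i).len y')⁻¹) := by
  intro y' A hA y
  have hΛ : 0 < (geo9K i).len y' := geo9K_len_pos i y'
  rw [bHZKPI_loc]
  calc b₂.loc y (T A) ≤ K y y' * (bHZKP (κ := κ) i b g (R := R) (H := H) hs0 hs1).loc y' A := h y' A hA y
    _ = K y y' * ((geo9K i).len y')⁻¹ * ((geo9K i).len y' * (bHZKP (κ := κ) i b g (R := R) (H := H) hs0 hs1).loc y' A) := by
        field_simp

end Bond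

/-! ## §2 The (2.60) weight moves between length-weighted sources and the `𝔠^{(t)}` targets -/

section Weights

variable {gB : B9.Geometry} [Fintype gB.Site] {R₀ : ℝ} {H₀ : Prop}
variable {F₁ : Type} [AddCommGroup F₁] [Module ℝ F₁] {X : Type} [Fintype X]

/-- the sharp-block target `ofBlocks blk` IS `𝔠^{(0)}_{blk}` (weight `(Lʲη)⁰ = 1`). [cite: Balaban1984PropagatorsII, (2.51) p.232, bookkeeping] -/
theorem hasMaj_cNormR_zero_of_ofBlocks (hlen : ∀ y : gB.Site, 0 ≤ gB.len y) {N : BlockNorm (toB6 gB R₀ H₀) F₁} {blk : X → gB.Site} {T : F₁ →ₗ[ℝ] (X → ℝ)}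
    {K : gB.Site → gB.Site → ℝ} (h : HasMaj N (BlockNorm.ofBlocks (toB6 gB R₀ H₀) blk) T K) : HasMaj N (cNormR R₀ H₀ blk hlen 0) T K := by
  intro y' A hA y
  rw [cNormR_loc, Real.rpow_zero, one_mul]
  exact h y' A hA y

/-- a power `(Lʲη)^{−t}` at the OUTPUT block moves from the kernel into the target weight `𝔠^{(t)}` (p. 398 «the choice of powers Lʲη is conventional», exact part).
[cite: Balaban1985BackgroundPropagators, p.398 (remark after (3.47)) + (3.45) p.398 («(Lʲη)^{−β}»); Balaban1984PropagatorsII, (2.51) p.232] -/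
theorem hasMaj_cNormR_of_target_rpow (hG : GeoOK gB) {N : BlockNorm (toB6 gB R₀ H₀) F₁} {blk : X → gB.Site} {T : F₁ →ₗ[ℝ] (X → ℝ)}
    {C E : gB.Site → gB.Site → ℝ} {t : ℝ} (h : HasMaj N (BlockNorm.ofBlocks (toB6 gB R₀ H₀) blk) T (fun a a' => C a a' * gB.len a ^ (-t) * E a a')) :
    HasMaj N (cNormR R₀ H₀ blk hG.lenle t) T (fun a a' => C a a' * E a a') := by
  intro y' A hA y
  have hΛ : 0 < gB.len y := hG.lenpos y
  have h0 : 0 ≤ gB.len y ^ t := Real.rpow_nonneg hΛ.le t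
  rw [cNormR_loc]
  calc gB.len y ^ t * (BlockNorm.ofBlocks (toB6 gB R₀ H₀) blk).loc y (T A)
      ≤ gB.len y ^ t * (C y y' * gB.len y ^ (-t) * E y y' * N.loc y' A) := mul_le_mul_of_nonneg_left (h y' A hA y) h0
    _ = (gB.len y ^ t * gB.len y ^ (-t)) * (C y y' * E y y') * N.loc y' A := by ring
    _ = C y y' * E y y' * N.loc y' A := by rw [Real.rpow_neg hΛ.le, mul_inv_cancel₀ (Real.rpow_pos_of_pos hΛ t).ne', one_mul]

/-- ★ **UN-WEIGHTING A LENGTH-WEIGHTED SOURCE BY (2.60).**  If `T` is bounded from the `Lʲη`-weighted class `weightNorm N (Lʲη)` into `𝔠^{(t)}_{blk}` by `K e^{−ρd}` and the scale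
transfer `L^{j′}η ≦ A e^{εd(y,y′)} Lʲη` holds (the geometric form of [4] (2.60) above an `M`-threshold), then `T` is bounded from `N` into `𝔠^{(t−1)}_{blk}` by `A·K·e^{−(ρ−ε)d}` —
one length moves from the source block to the target block at the cost `L^{|j−j′|} ≦ A e^{εd}`. [cite: Balaban1984PropagatorsII, Lemma 2.1 (2.60) p.234 + (2.51) p.232; Balaban1985BackgroundPropagators, p.398 (remark after (3.47)) + (3.44) p.398] -/
theorem hasMaj_unweight_src_cNormR (hG : GeoOK gB) {N : BlockNorm (toB6 gB R₀ H₀) F₁} {blk : X → gB.Site} {T : F₁ →ₗ[ℝ] (X → ℝ)} {t K ρ ε A : ℝ}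
    (hK : 0 ≤ K) (hT : ∀ a a' : gB.Site, gB.len a' ≤ A * Real.exp (ε * gB.dist a a') * gB.len a)
    (h : HasMaj (weightNorm N (fun y => gB.len y) (fun y => (hG.lenpos y).le)) (cNormR R₀ H₀ blk hG.lenle t) T
      (fun a a' => K * Real.exp (-(ρ * gB.dist a a')))) :
    HasMaj N (cNormR R₀ H₀ blk hG.lenle (t - 1)) T (fun a a' => A * K * Real.exp (-((ρ - ε) * gB.dist a a'))) := by
  intro y' A₁ hA y
  have hΛ : 0 < gB.len y := hG.lenpos y
  have hΛ' : 0 ≤ gB.len y' := hG.lenle y'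
  have hN : 0 ≤ N.loc y' A₁ := N.loc_nonneg _ _
  have hE : 0 ≤ K * Real.exp (-(ρ * gB.dist y y')) := mul_nonneg hK (Real.exp_nonneg _)
  have h1 := h y' A₁ hA y
  rw [weightNorm_loc, cNormR_loc] at h1
  rw [cNormR_loc]
  have hsplit : gB.len y ^ (t - 1) = (gB.len y)⁻¹ * gB.len y ^ t := by
    rw [Real.rpow_sub hΛ, Real.rpow_one, div_eq_inv_mul]
  calc gB.len y ^ (t - 1) * (BlockNorm.ofBlocks (toB6 gB R₀ H₀) blk).loc y (T A₁)
      = (gB.len y)⁻¹ * (gB.len y ^ t * (BlockNorm.ofBlocks (toB6 gB R₀ H₀) blk).loc y (T A₁)) := by rw [hsplit, mul_assoc]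
    _ ≤ (gB.len y)⁻¹ * (K * Real.exp (-(ρ * gB.dist y y')) * (gB.len y' * N.loc y' A₁)) := mul_le_mul_of_nonneg_left h1 (inv_nonneg.2 hΛ.le)
    _ ≤ (gB.len y)⁻¹ * (K * Real.exp (-(ρ * gB.dist y y')) * ((A * Real.exp (ε * gB.dist y y') * gB.len y) * N.loc y' A₁)) :=
        mul_le_mul_of_nonneg_left (mul_le_mul_of_nonneg_left (mul_le_mul_of_nonneg_right (hT y y') hN) hE) (inv_nonneg.2 hΛ.le)
    _ = ((gB.len y)⁻¹ * gB.len y) * (A * K * (Real.exp (-(ρ * gB.dist y y')) * Real.exp (ε * gB.dist y y'))) * N.loc y' A₁ := by ring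
    _ = A * K * Real.exp (-((ρ - ε) * gB.dist y y')) * N.loc y' A₁ := by
        rw [inv_mul_cancel₀ hΛ.ne', one_mul, ← Real.exp_add]
        congr 2; ring

end Weights

section Transfer

omit [Fintype (geo9K i).Site] in
/-- ★ **[4] (2.60) AS THE ONE-LENGTH SCALE TRANSFER ABOVE A THRESHOLD**: at every rate `ε > 0`, every member with `log L ≦ ε·(2L² − 1)·M` has `L^{j′}η ≦ L·e^{εd(y,y′)}·Lʲη` for all
blocks `y, y′` (`B9GeoLemma21KLevelV1.transferL_geo9K` at `q = 1`). [cite: Balaban1984PropagatorsII, Lemma 2.1 (2.60) p.234 with (2.88) p.238] -/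
theorem len_le_transfer_geo9K {ε : ℝ} (hε : 0 < ε) (hM : Real.log (geo9K i).L ≤ ε * (2 * ((ℓ : ℝ) + 1) ^ 2 - 1) * (geo9K i).M) (a a' : IBondY i) :
    (geo9K i).len a' ≤ (((ℓ + 1 : ℕ) : ℝ)) * Real.exp (ε * (geo9K i).dist a a') * (geo9K i).len a := by
  have hT := transferL_geo9K i hε 1 (by rwa [abs_one, one_mul]) a a'
  rwa [Real.rpow_one, Real.rpow_one, abs_one, Real.rpow_one] at hT

omit [Fintype (geo9K i).Site] in
/-- the threshold form: `M ≥ log L ∕ (ε(2L² − 1))` implies the hypothesis of `len_le_transfer_geo9K`. [cite: Balaban1984PropagatorsII, Lemma 2.1 (2.60) p.234, bookkeeping] -/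
theorem transfer_threshold_geo9K {ε : ℝ} (hε : 0 < ε)
    (hM : Real.log (((ℓ + 1 : ℕ) : ℝ)) / (ε * (2 * ((ℓ : ℝ) + 1) ^ 2 - 1)) ≤ (geo9K i).M) :
    Real.log (geo9K i).L ≤ ε * (2 * ((ℓ : ℝ) + 1) ^ 2 - 1) * (geo9K i).M := by
  have hL : (geo9K i).L = ((ℓ + 1 : ℕ) : ℝ) := rfl
  have hq : (1 : ℝ) ≤ 2 * ((ℓ : ℝ) + 1) ^ 2 - 1 := by nlinarith [(Nat.cast_nonneg ℓ : (0 : ℝ) ≤ ℓ)]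
  have hpos : 0 < ε * (2 * ((ℓ : ℝ) + 1) ^ 2 - 1) := mul_pos hε (by linarith)
  rw [hL]
  have h := (div_le_iff₀ hpos).1 hM
  linarith [h, mul_comm ((geo9K i).M) (ε * (2 * ((ℓ : ℝ) + 1) ^ 2 - 1))]

end Transfer

/-! ## §3 ★★ The direction slice between the print-exact classes: `dirSliceK μ ν : bHZKPI (taxiB U) s → bHZPI (taxiS U) s` -/

section Slice

variable [CompleteSpace 𝔸] {B : B9.Backgrounds} (cfg : B.Cfg → CfgY 𝔸 i) (U₁ : B.Cfg)
variable {R₀ : ℝ} {H₀ : Prop} {bI : FBondY i → IBondY i}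

/-- ★★ **THE HÖLDER-SOURCE SECTOR COMPARISON AT THE PRINT-EXACT CLASSES.**  For unitary-like bond variables, a `1`-faithful `bI`, print's units, `0 < s < 1`, every `δ ≥ 0` and every
transfer rate `ε > 0` above its (2.60) threshold `log L ≦ ε(2L²−1)M`: the direction slice is bounded `bHZKPI (taxiB U) s → bHZPI (taxiS U) s` with majorant
`L·C_σ·e^{δr_σ}·e^{−(δ−ε)d(y,y′)}`, `C_σ = L³(2 + 2c_bb_bL²)`, `r_σ = 2(r_near+1) + ((d+1)(L+1)+2)` — this lineage's B1 `hasMaj_dirSliceK_bHZKP_bHZP` with both sides re-weighted by `Lʲη`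
(`B9SectDSup.HasMaj.weight`), the ratio `Lʲη∕L^{j′}η ≦ L·e^{εd}` by (2.60). [cite: Balaban1985BackgroundPropagators, (3.40) p.397 + (3.44)–(3.45) p.398; Balaban1984PropagatorsII, Lemma 2.1 (2.60) p.234, (2.51)–(2.54) pp.232–233] -/
theorem hasMaj_dirSliceK_bHZKPI_bHZPI [NormOneClass 𝔸] [FiniteDimensional ℝ 𝔸] (hU : ∀ μ' t, UnitaryLike (cfg U₁ μ' t))
    (hβ1 : ∀ f : FBondY i, (geomT i.D).dist (β i.hN i.D i.hk (bI f)) (blkV1 i.hN i.D f) ≤ 1) (hcf : |i.cf| = (nKT (toKT i) : ℝ))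
    {s : ℝ} (hs0 : 0 < s) (hs1 : s < 1) {δ ε : ℝ} (hδ : 0 ≤ δ) (hε : 0 < ε)
    (hM : Real.log (geo9K i).L ≤ ε * (2 * ((ℓ : ℝ) + 1) ^ 2 - 1) * (geo9K i).M) (μ ν : Fin (d + 1)) :
    HasMaj (bHZKPI (κ := κ) i b (taxiB i B cfg U₁) (R := R₀) (H := H₀) hs0.le hs1.le)
      (bHZPI (κ := κ) i b (taxiS i B cfg U₁) (R := R₀) (H := H₀) hs0.le hs1.le) (dirSliceK i μ ν)
      (fun y y' => (((ℓ + 1 : ℕ) : ℝ)) * ((((ℓ + 1 : ℕ) : ℝ)) ^ 3 * (2 + 2 * coordBound39 b * basisBound39 b * (((ℓ + 1 : ℕ) : ℝ)) ^ 2)) *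
        Real.exp (δ * (2 * (rNear d ℓ + 1) + (((d : ℝ) + 1) * (((ℓ : ℝ) + 1) + 1) + 2))) * Real.exp (-((δ - ε) * (geo9K i).dist y y'))) := by
  have hB1 := hasMaj_dirSliceK_bHZKP_bHZP (κ := κ) i b cfg U₁ (R₀ := R₀) (H₀ := H₀) (bI := bI) hU hβ1 hcf hs0 hs1 hδ μ ν
  have hT := len_le_transfer_geo9K i hε hM
  set Cσ : ℝ := (((ℓ + 1 : ℕ) : ℝ)) ^ 3 * (2 + 2 * coordBound39 b * basisBound39 b * (((ℓ + 1 : ℕ) : ℝ)) ^ 2) with hCσ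
  set Eσ : ℝ := Real.exp (δ * (2 * (rNear d ℓ + 1) + (((d : ℝ) + 1) * (((ℓ : ℝ) + 1) + 1) + 2))) with hEσ
  have hcb : 0 ≤ coordBound39 b := by unfold coordBound39; exact norm_nonneg _
  have hbb : 0 ≤ basisBound39 b := Finset.sum_nonneg fun _ _ => norm_nonneg _
  have hC0 : 0 ≤ Cσ * Eσ := by rw [hCσ, hEσ]; positivity
  refine B9SectDSup.HasMaj.weight (fun y => (geo9K_len_pos i y).le) (fun y => (geo9K_len_pos i y).le) hB1 fun y y' => ?_
  have hsymm : (geo9K i).dist y' y = (geo9K i).dist y y' := B9GeoLemma21KLevelV1.geo9K_dist_comm i y' y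
  have hy : (geo9K i).len y ≤ (((ℓ + 1 : ℕ) : ℝ)) * Real.exp (ε * (geo9K i).dist y y') * (geo9K i).len y' := by
    have h := hT y' y
    rwa [hsymm] at h
  have hE0 : 0 ≤ Real.exp (-(δ * (geo9K i).dist y y')) := Real.exp_nonneg _
  calc (geo9K i).len y * (Cσ * Eσ * Real.exp (-(δ * (geo9K i).dist y y')))
      ≤ ((((ℓ + 1 : ℕ) : ℝ)) * Real.exp (ε * (geo9K i).dist y y') * (geo9K i).len y') * (Cσ * Eσ * Real.exp (-(δ * (geo9K i).dist y y'))) :=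
        mul_le_mul_of_nonneg_right hy (mul_nonneg hC0 hE0)
    _ = (((ℓ + 1 : ℕ) : ℝ)) * (Cσ) * Eσ * (Real.exp (-(δ * (geo9K i).dist y y')) * Real.exp (ε * (geo9K i).dist y y')) * (geo9K i).len y' := by ring
    _ = (((ℓ + 1 : ℕ) : ℝ)) * (Cσ) * Eσ * Real.exp (-((δ - ε) * (geo9K i).dist y y')) * (geo9K i).len y' := by
        rw [← Real.exp_add]; congr 3; ring

end Slice

/-! ## §4 The un-weighting at the print-exact bond class (the form the assemblers consume) -/

section Unweight

variable (g : FBondY i → FBondY i → 𝔸ˣ) {R : ℝ} {H : Prop} {s : ℝ} (hs0 : 0 ≤ s) (hs1 : s ≤ 1)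

/-- ★ **FROM THE PRINT-EXACT BOND CLASS INTO `𝔠^{(t)}` TO THE PRINT-WEIGHTED BOND CLASS INTO `𝔠^{(t−1)}`** by (2.60): `hasMaj_unweight_src_cNormR` at `N := bHZKP g s` — the last step
of the `h44G` (`t = 0`: target `𝔠^{(−1)} = 𝔠⁽¹⁾`) and `hp45W` (`t = β′`: target `𝔠_P^{(β′−1)}`) assemblers. [cite: Balaban1984PropagatorsII, Lemma 2.1 (2.60) p.234 + (2.51) p.232; Balaban1985BackgroundPropagators, (3.44)–(3.45) p.398 + p.398 (remark after (3.47))] -/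
theorem hasMaj_bHZKP_of_bHZKPI (hG : GeoOK (geo9K i)) {X : Type} [Fintype X] {blk : X → IBondY i} {T : (XBK κ i → ℝ) →ₗ[ℝ] (X → ℝ)} {t K ρ ε A : ℝ}
    (hK : 0 ≤ K) (hT : ∀ a a' : IBondY i, (geo9K i).len a' ≤ A * Real.exp (ε * (geo9K i).dist a a') * (geo9K i).len a)
    (h : HasMaj (bHZKPI (κ := κ) i b g (R := R) (H := H) hs0 hs1) (cNormR R H blk hG.lenle t) T (fun a a' => K * Real.exp (-(ρ * (geo9K i).dist a a')))) :
    HasMaj (bHZKP (κ := κ) i b g (R := R) (H := H) hs0 hs1) (cNormR R H blk hG.lenle (t - 1)) T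
      (fun a a' => A * K * Real.exp (-((ρ - ε) * (geo9K i).dist a a'))) :=
  hasMaj_unweight_src_cNormR hG hK hT h

end Unweight

/-! ## §5 (v1.1, append-only) The total exponent family of the print-exact BOND class: `bHZKPIfam g` -/

section BondFam

variable (g : FBondY i → FBondY i → 𝔸ˣ) {R : ℝ} {H : Prop}

/-- ★ **THE TOTAL EXPONENT FAMILY `bHZKPIfam g : ℝ → BlockNorm` ON BONDS** — `bHZKPI g s` for `s ∈ [0,1]` (junk `bHZKPI g ½` elsewhere): the shape of the abstract input
class `bHX : ℝ → BlockNorm` of the G-side (3.44)∕(3.45) engine (`B9RWSums344InputPairGDir.inputPair3445_of_local310_dir`, `B9Thm312WholeFromThm310R1A.thm33G0Dir_of_conv3107₂`),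
whose legs `InputLegsPair310 ∕ FactorsInputPair310` quantify `∀ ε, 0 < ε → ε ≤ 1`. [cite: Balaban1985BackgroundPropagators, (3.44)–(3.45) p.398 + Thm 3.10 p.414, dictionary] -/
def bHZKPIfam : ℝ → BlockNorm (toB6 (geo9K i) R H) (XBK κ i → ℝ) := fun ε =>
  if h : 0 ≤ ε ∧ ε ≤ 1 then bHZKPI (κ := κ) i b g (R := R) (H := H) h.1 h.2
  else bHZKPI (κ := κ) i b g (R := R) (H := H) (s := 1 / 2) (by norm_num) (by norm_num)

/-- on `[0,1]` the bond family IS the print-exact bond class. [cite: Balaban1985BackgroundPropagators, (3.44) p.398, bookkeeping] -/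
theorem bHZKPIfam_of_mem {ε : ℝ} (h0 : 0 ≤ ε) (h1 : ε ≤ 1) :
    bHZKPIfam (κ := κ) i b g (R := R) (H := H) ε = bHZKPI (κ := κ) i b g (R := R) (H := H) h0 h1 := by
  unfold bHZKPIfam
  rw [dif_pos ⟨h0, h1⟩]

end BondFam

end Literature.MathematicalPhysics.QuantumFieldTheory.Balaban1983to89.B9SmoothHolderClassPI

end
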